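import Literature.Analysis.SingularIntegrals.TruncatedKernelFourierBound
import Mathlib.Analysis.Fourier.Convolution
import Literature.Analysis.Convolution.YoungInequality
import Literature.Analysis.FunctionSpaces.PlancherelL1L2
import HarnessLib

/-!
# Truncated singular integrals are bounded on `L²`, uniformly in the truncation (Grafakos, CFA, Thm. 5.4.1)

Topic `Literature/Analysis/SingularIntegrals`. Theorems only.

**Grafakos, *Classical Fourier Analysis* (3rd ed. 2014), Thm. 5.4.1, first consequence of (5.4.4).** For a (real)
kernel `K` satisfying the size, Hörmander and cancellation conditions (5.4.1)–(5.4.3) with constants `A₁, A₂, A₃`,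
and every `0 < ε < N`, the truncated singular integral `f ↦ (K χ_{ε<|·|<N}) ∗ f` satisfies
`‖(K χ_{ε<|·|<N}) ∗ f‖_{L²} ≤ 15 (A₁ + A₂ + A₃) ‖f‖_{L²}` for `f ∈ L¹ ∩ L²`
(`eLpNorm_truncatedKernel_convolution_le`).  Proof: the truncated kernel is integrable, so `k ∗ f ∈ L¹ ∩ L²`
(Young, `Literature.Analysis.Convolution.memLp_convolution_young`); by Plancherel on `L¹ ∩ L²`
(`Literature.Analysis.FunctionSpaces.eLpNorm_fourierIntegral_eq`) and the convolution theorem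
(`Real.fourier_mul_convolution_eq`), `‖k ∗ f‖₂ = ‖k̂ f̂‖₂ ≤ ‖k̂‖_∞ ‖f̂‖₂ = ‖k̂‖_∞ ‖f‖₂`, and `‖k̂‖_∞ ≤ 15(A₁+A₂+A₃)`
is `norm_fourier_indicator_annulus_le` (file `TruncatedKernelFourierBound`).

This is the `L²` hypothesis of the Calderón–Zygmund theory in this directory (`CalderonZygmundWeakType`,
`CalderonZygmundLp`), now available for standard kernels.

## References

* L. Grafakos, *Classical Fourier Analysis*, 3rd ed., GTM 249, Springer 2014, Thm. 5.4.1 (key `Grafakos2014`).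
-/

noncomputable section

open MeasureTheory Metric Set Filter Complex
open scoped Real Topology RealInnerProductSpace FourierTransform

namespace Literature.Analysis.SingularIntegrals

variable {V : Type*} [NormedAddCommGroup V] [InnerProductSpace ℝ V] [FiniteDimensional ℝ V]
  [MeasurableSpace V] [BorelSpace V]

section L2Bound

open scoped _root_.Convolution ENNReal

variable [Nontrivial V] {K : V → ℝ} {A₁ A₂ A₃ : ℝ}

/-- **`L²`-boundedness of truncated singular integrals, uniformly in the truncation** (Grafakos CFA Thm. 5.4.1,
consequence of (5.4.4) by Plancherel): for a real kernel `K` with (5.4.1)–(5.4.3) and `f ∈ L¹ ∩ L²(V; ℂ)`,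
`‖(K χ_{ε<|·|<N}) ∗ f‖_{L²} ≤ 15 (A₁ + A₂ + A₃) ‖f‖_{L²}`. [cite: Grafakos2014, Thm. 5.4.1] -/
theorem eLpNorm_truncatedKernel_convolution_le
    (hK : ∀ a b, 0 < a → IntegrableOn K (closedBall (0 : V) b \ ball 0 a))
    (h1 : ∀ R, 0 < R → ∫ x in closedBall (0 : V) (2 * R) \ ball 0 R, ‖K x‖ ≤ A₁)
    (h2 : ∀ y : V, y ≠ 0 → ∀ N : ℝ, ∫ x in closedBall (0 : V) N \ ball 0 (2 * ‖y‖), ‖K (x - y) - K x‖ ≤ A₂)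
    (h3 : ∀ a b, 0 < a → a < b → ‖∫ x in ball (0 : V) b \ closedBall 0 a, K x‖ ≤ A₃)
    {ε N : ℝ} (hε : 0 < ε) (hεN : ε < N) {f : V → ℂ} (hf : Integrable f) (hf2 : MemLp f 2) :
    eLpNorm ((ball (0 : V) N \ closedBall 0 ε).indicator K ⋆[ContinuousLinearMap.lsmul ℝ ℝ, volume] f) 2 volume ≤
      ENNReal.ofReal (15 * (A₁ + A₂ + A₃)) * eLpNorm f 2 volume := by
  -- nonnegativity of the constant
  have hA₁ : 0 ≤ A₁ := le_trans (integral_nonneg fun _ ↦ norm_nonneg _) (h1 1 one_pos)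
  have hA₂ : 0 ≤ A₂ := by
    obtain ⟨y, hy⟩ := exists_ne (0 : V)
    exact le_trans (integral_nonneg fun _ ↦ norm_nonneg _) (h2 y hy 0)
  have hA₃ : 0 ≤ A₃ := le_trans (norm_nonneg _) (h3 1 2 one_pos one_lt_two)
  have hC : 0 ≤ 15 * (A₁ + A₂ + A₃) := by positivity
  set A : Set V := ball (0 : V) N \ closedBall 0 ε with hA
  have hAm : MeasurableSet A := measurableSet_ball.diff measurableSet_closedBall
  set k : V → ℝ := A.indicator K with hk
  have hk1 : Integrable k volume := by
    rw [hk, integrable_indicator_iff hAm]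
    exact (hK ε N hε).mono_set (sdiff_subset_sdiff ball_subset_closedBall ball_subset_closedBall)
  -- `k ⋆ f ∈ L¹ ∩ L²`
  have hI : Integrable (k ⋆[ContinuousLinearMap.lsmul ℝ ℝ, volume] f) volume :=
    hk1.integrable_convolution _ hf
  have hY : MemLp (k ⋆[ContinuousLinearMap.lsmul ℝ ℝ, volume] f) 2 volume := by
    refine Literature.Analysis.Convolution.memLp_convolution_young (b := 1) (m := 2) (r := 2)
      (memLp_one_iff_integrable.2 hk1) hf2 le_rfl (by norm_num) ?_
    rw [inv_one]
  -- the complexified kernel and the convolution theorem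
  set kc : V → ℂ := fun x ↦ (k x : ℂ) with hkc
  have hkc1 : Integrable kc volume := hk1.ofReal
  have hconv : (k ⋆[ContinuousLinearMap.lsmul ℝ ℝ, volume] f) = (kc ⋆[ContinuousLinearMap.mul ℂ ℂ, volume] f) := by
    funext x
    simp only [convolution_def, ContinuousLinearMap.lsmul_apply, ContinuousLinearMap.mul_apply', hkc,
      Complex.real_smul]
  have hkc_eq : kc = A.indicator (fun x ↦ (K x : ℂ)) := by
    funext x
    simp only [hkc, hk, Set.indicator]
    split_ifs <;> simp
  -- the Fourier bound for the complexified kernel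
  have hbound : ∀ ξ, ‖𝓕 kc ξ‖ ≤ 15 * (A₁ + A₂ + A₃) := by
    intro ξ
    rw [hkc_eq]
    refine norm_fourier_indicator_annulus_le (K := fun x ↦ (K x : ℂ)) (fun a b ha ↦ (hK a b ha).ofReal)
      (fun R hR ↦ ?_) (fun y hy N' ↦ ?_) (fun a b ha hab ↦ ?_) hε hεN ξ
    · simp only [Complex.norm_real]; exact h1 R hR
    · simp only [← Complex.ofReal_sub, Complex.norm_real]; exact h2 y hy N'
    · rw [integral_complex_ofReal, Complex.norm_real]; exact h3 a b ha hab
  -- Plancherel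
  calc eLpNorm (k ⋆[ContinuousLinearMap.lsmul ℝ ℝ, volume] f) 2 volume
      = eLpNorm (𝓕 (k ⋆[ContinuousLinearMap.lsmul ℝ ℝ, volume] f)) 2 volume :=
        (Literature.Analysis.FunctionSpaces.eLpNorm_fourierIntegral_eq hI hY).symm
    _ = eLpNorm (fun ξ ↦ 𝓕 kc ξ * 𝓕 f ξ) 2 volume := by
        rw [hconv]
        congr 1; funext ξ
        exact Real.fourier_mul_convolution_eq hkc1 hf ξ
    _ ≤ ENNReal.ofReal (15 * (A₁ + A₂ + A₃)) * eLpNorm (𝓕 f) 2 volume := by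
        refine eLpNorm_le_mul_eLpNorm_of_ae_le_mul (ae_of_all _ fun ξ ↦ ?_) 2
        rw [norm_mul]
        exact mul_le_mul_of_nonneg_right (hbound ξ) (norm_nonneg _)
    _ = ENNReal.ofReal (15 * (A₁ + A₂ + A₃)) * eLpNorm f 2 volume := by
        rw [Literature.Analysis.FunctionSpaces.eLpNorm_fourierIntegral_eq hf hf2]

end L2Bound

end Literature.Analysis.SingularIntegrals

end
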